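import Literature.Barriers.ValiantsHypothesis.GCTMatrixPoweringProp18
import Literature.Barriers.ValiantsHypothesis.GCTMatrixPoweringAtomsA
import Literature.Barriers.ValiantsHypothesis.GCTMatrixPoweringAtomsB
import Literature.Barriers.ValiantsHypothesis.GCTMatrixPoweringAtomsC
import Literature.Barriers.ValiantsHypothesis.GCTMatrixPoweringAtomsD
import Literature.Barriers.ValiantsHypothesis.GCTMatrixPoweringAtomsE
import Literature.Barriers.ValiantsHypothesis.GCTMatrixPoweringAtomsF
import Literature.Barriers.ValiantsHypothesis.GCTMatrixPoweringAtomsG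
import Literature.Barriers.ValiantsHypothesis.GCTMatrixPoweringAtomsH
import Literature.Barriers.ValiantsHypothesis.GCTMatrixPoweringAtomsI
import Literature.Barriers.ValiantsHypothesis.GCTMatrixPoweringAtomsJ
import HarnessLib

/-!
# Gesmundo–Ikenmeyer–Panova 2017: Prop. 18 (corrected), Prop. 20 (corrected), Prop. 14, Thm. 10
# and the barrier `GCTMatrixPowering` — DISCHARGED

Sibling proofs file (D-0014; theorems only) of `GCTMatrixPoweringErratum.lean` (the named facts
`GIP2017_prop18_corrected`, `GIP2017_prop20_corrected`), `GCTMatrixPoweringProp18.lean`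
(`GIP2017_prop18_corrected_of_atoms`: the corrected Prop. 18 from its 64 atoms (A1)–(A8), the
semigroup step of the printed proof) and `GCTMatrixPoweringProp17.lean`
(`GIP2017_prop20_corrected_of_prop18`, `gctMatrixPowering_of_prop18`: GIP's proof of Prop. 20 and
of Thm. 10 with Props. 15, 17, 19 (corrected), 14, Lemma 12, Prop. 13, Thm. 16 all proved).

GIP (arXiv:1611.00827 = Diff. Geom. Appl. 55 (2017), §3, held text p. 11) prove Prop. 18 — "Let
`λ` be a partition of length `ℓ ≤ 14` and `λ ∉ {(1^r) : r ∈ X_s} ∪ {(2,1,1), (3,1,1), (2,1⁷)}`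
[∪ {(2,1³)}, the erratum of `GCTMatrixPoweringErratum.lean`]. Then `sm(λ,7) > 0`" — by "a direct
computation" with "a program written by Harm Derksen and adjusted by Jesko Hüttenhain" for the
shapes with at most three columns of lengths in `[2, 14]`, followed by the semigroup property. The
tree's reduction leaves exactly 64 two- and three-column shapes (the atoms (A1)–(A8)); each is
certified IN THE KERNEL in `GCTMatrixPoweringAtomsA–J.lean` by one explicit `μ` with at most five
rows and `sk(λ, μ) > 0` (resp. `ak(λ, μ) > 0`), evaluated by the verified Murnaghan–Nakayama
evaluator of `Literature/RepresentationTheory/FiniteGroups/SymmetricGroupSquareEvaluation.lean`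
through the certificates of `GCTMatrixPoweringSkEval.lean`. This file plugs them in:

* `atoms_A1`, `atoms_A3`, `atoms_A4`, `atoms_A6`, `atoms_A7`, `atoms_A8` — the families in the exact form of
  the hypotheses of `GIP2017_prop18_corrected_of_atoms` (finite case splits over the listed column
  lengths; (A2) = `sm_c2_2_2` and (A5) = `sm_c3_3_3` are single atoms);
* **`GIP2017_prop18_corrected_holds`**, **`GIP2017_prop20_corrected_holds`**,
  `GIP2017_prop14_holds`, **`GIP2017_thm10_holds`**, **`GCTMatrixPowering_holds`** — GIP's Main
  Result (Thm. 10: no orbit occurrence obstructions for matrix powering with `ℓ(λ) ≤ m²`) and the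
  barrier fact now rest on no named fact at all.

## References

* [GesmundoIkenmeyerPanova2017] F. Gesmundo, C. Ikenmeyer, G. Panova, *Geometric complexity
  theory and matrix powering*, Diff. Geom. Appl. 55 (2017) 106–127 = arXiv:1611.00827: §3
  (Props. 15, 17, 18, 19, 20; the proof of Prop. 18, held text p. 11), Prop. 14, Thm. 10.
-/

noncomputable section

namespace Literature.Barriers.ValiantsHypothesis

open Literature.NumberTheory.DiophantineGeometry Literature.Computability.Complexity Finset

/-! ### 1. The eight families of atoms -/

/-- **(A1)** `sm(1² + 1^x, 7) > 0` for `x ∈ {1,3,4,…,14}` (the shapes `(2,1)`, `(2,2,1^{x-2})`; kernel).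
[cite: GesmundoIkenmeyerPanova2017, Prop. 18 (proof: "a direct computation")] -/
theorem atoms_A1 : ∀ x ∈ ({1, 3, 4, 5, 6, 7, 8, 9, 10, 11, 12, 13, 14} : Finset ℕ),
    SmPos 7 (ofColumns {2, x}) := by
  intro x hx
  simp only [Finset.mem_insert, Finset.mem_singleton] at hx
  rcases hx with rfl | rfl | rfl | rfl | rfl | rfl | rfl | rfl | rfl | rfl | rfl | rfl | rfl
  · exact sm_c2_1
  · exact sm_c3_2
  · exact sm_c4_2
  · exact sm_c5_2
  · exact sm_c6_2
  · exact sm_c7_2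
  · exact sm_c8_2
  · exact sm_c9_2
  · exact sm_c10_2
  · exact sm_c11_2
  · exact sm_c12_2
  · exact sm_c13_2
  · exact sm_c14_2

/-- **(A3)** `sm(1^a + 1^b, 7) > 0` for `a ∈ {1,5,6,10,14}`, `b ∈ {3,4,7,8,12}`, `1^a + 1^b` not one of
the exceptional `(2,1,1)`, `(2,1³)`, `(2,1⁷)` (22 two-column shapes; kernel).
[cite: GesmundoIkenmeyerPanova2017, Prop. 18 (proof: "a direct computation")] -/
theorem atoms_A3 : ∀ a ∈ ({1, 5, 6, 10, 14} : Finset ℕ), ∀ b ∈ ({3, 4, 7, 8, 12} : Finset ℕ),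
    ¬ (a = 1 ∧ (b = 3 ∨ b = 4 ∨ b = 8)) → SmPos 7 (ofColumns {a, b}) := by
  intro a ha b hb hne
  simp only [Finset.mem_insert, Finset.mem_singleton] at ha hb
  rcases ha with rfl | rfl | rfl | rfl | rfl <;> rcases hb with rfl | rfl | rfl | rfl | rfl
  · exact absurd ⟨rfl, Or.inl rfl⟩ hne
  · exact absurd ⟨rfl, Or.inr (Or.inl rfl)⟩ hne
  · exact sm_c7_1
  · exact absurd ⟨rfl, Or.inr (Or.inr rfl)⟩ hne
  · exact sm_c12_1
  · exact sm_c5_3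
  · exact sm_c5_4
  · exact sm_c7_5
  · exact sm_c8_5
  · exact sm_c12_5
  · exact sm_c6_3
  · exact sm_c6_4
  · exact sm_c7_6
  · exact sm_c8_6
  · exact sm_c12_6
  · exact sm_c10_3
  · exact sm_c10_4
  · exact sm_c10_7
  · exact sm_c10_8
  · exact sm_c12_10
  · exact sm_c14_3
  · exact sm_c14_4
  · exact sm_c14_7
  · exact sm_c14_8
  · exact sm_c14_12

/-- **(A4)** `am(1^x + 1^y, 7) > 0` for `x, y ∈ {3,4,7,8,12}`, `{x, y} ≠ {3, 3}` (14 two-column shapes;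
kernel; `am((2,2,2), 7) = 0`). [cite: GesmundoIkenmeyerPanova2017, Prop. 18 (proof: "a direct computation")] -/
theorem atoms_A4 : ∀ x ∈ ({3, 4, 7, 8, 12} : Finset ℕ), ∀ y ∈ ({3, 4, 7, 8, 12} : Finset ℕ),
    ¬ (x = 3 ∧ y = 3) → AmPos 7 (ofColumns {x, y}) := by
  intro x hx y hy h33
  simp only [Finset.mem_insert, Finset.mem_singleton] at hx hy
  rcases hx with rfl | rfl | rfl | rfl | rfl <;> rcases hy with rfl | rfl | rfl | rfl | rfl
  · exact absurd ⟨rfl, rfl⟩ h33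
  · exact (Multiset.pair_comm 4 3) ▸ am_c4_3
  · exact (Multiset.pair_comm 7 3) ▸ am_c7_3
  · exact (Multiset.pair_comm 8 3) ▸ am_c8_3
  · exact (Multiset.pair_comm 12 3) ▸ am_c12_3
  · exact am_c4_3
  · exact am_c4_4
  · exact (Multiset.pair_comm 7 4) ▸ am_c7_4
  · exact (Multiset.pair_comm 8 4) ▸ am_c8_4
  · exact (Multiset.pair_comm 12 4) ▸ am_c12_4
  · exact am_c7_3
  · exact am_c7_4
  · exact am_c7_7
  · exact (Multiset.pair_comm 8 7) ▸ am_c8_7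
  · exact (Multiset.pair_comm 12 7) ▸ am_c12_7
  · exact am_c8_3
  · exact am_c8_4
  · exact am_c8_7
  · exact am_c8_8
  · exact (Multiset.pair_comm 12 8) ▸ am_c12_8
  · exact am_c12_3
  · exact am_c12_4
  · exact am_c12_7
  · exact am_c12_8
  · exact am_c12_12

/-- **(A6)** `am(1² + 1^x, 7) > 0` for `x ∈ {3,4,7,8,12}` (kernel). [cite: GesmundoIkenmeyerPanova2017, Prop. 18 (proof: "a direct computation")] -/
theorem atoms_A6 : ∀ x ∈ ({3, 4, 7, 8, 12} : Finset ℕ), AmPos 7 (ofColumns {2, x}) := by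
  intro x hx
  simp only [Finset.mem_insert, Finset.mem_singleton] at hx
  rcases hx with rfl | rfl | rfl | rfl | rfl
  · exact am_c3_2
  · exact am_c4_2
  · exact am_c7_2
  · exact am_c8_2
  · exact am_c12_2

/-- **(A7)** `sm(1² + 1² + 1^x, 7) > 0` for `x ∈ {3,4,7,8,12}` (the shapes `(3,3,1^{x-2})`; kernel).
[cite: GesmundoIkenmeyerPanova2017, Prop. 18 (proof: "a direct computation")] -/
theorem atoms_A7 : ∀ x ∈ ({3, 4, 7, 8, 12} : Finset ℕ), SmPos 7 (ofColumns {2, 2, x}) := by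
  intro x hx
  simp only [Finset.mem_insert, Finset.mem_singleton] at hx
  rcases hx with rfl | rfl | rfl | rfl | rfl
  · exact sm_c3_2_2
  · exact sm_c4_2_2
  · exact sm_c7_2_2
  · exact sm_c8_2_2
  · exact sm_c12_2_2

/-- **(A8)** `sm((4,1,1), 7)`, `sm((3,1,1,1), 7)`, `sm((3,1⁷), 7) > 0` (the hooks with columns
`{3,1,1,1}`, `{4,1,1}`, `{8,1,1}`; kernel). [cite: GesmundoIkenmeyerPanova2017, Prop. 18 (proof: "a direct computation")] -/
theorem atoms_A8 : SmPos 7 (ofColumns {3, 1, 1, 1}) ∧ SmPos 7 (ofColumns {4, 1, 1}) ∧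
    SmPos 7 (ofColumns {8, 1, 1}) :=
  ⟨sm_c3_1_1_1, sm_c4_1_1, sm_c8_1_1⟩

/-! ### 2. The discharges -/

/-- **GIP Prop. 18 (corrected) — DISCHARGED**: "Let `λ` be a partition of length `ℓ ≤ 14` and
`λ ∉ {(1^r) : r ∈ X_s} ∪ {(2,1,1), (3,1,1), (2,1⁷)}` [corrected: `∪ {(2,1³)}`]. Then `sm(λ,7) > 0`"
— the printed computer calculation replaced by 64 kernel computations and the semigroup step
(`GIP2017_prop18_corrected_of_atoms`). [cite: GesmundoIkenmeyerPanova2017, Prop. 18] -/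
theorem GIP2017_prop18_corrected_holds : GIP2017_prop18_corrected :=
  GIP2017_prop18_corrected_of_atoms atoms_A1 sm_c2_2_2 atoms_A3 atoms_A4 sm_c3_3_3 atoms_A6
    atoms_A7 atoms_A8

/-- **GIP Prop. 20 (corrected) — DISCHARGED**: "Let `λ` be partition of length at most `L` and
`λ ∉ {(1²), (1³), (1⁴), (1⁷), (1⁸), (1¹²), (2,1²), (3,1²), (2,1⁷)}` [corrected: `∪ {(2,1³)}`] and also
`λ ≠ (2,2,1^k)` for any `k`. Let `ℓ := max{⌈√L⌉ + 2, 12}`. Then `sm(λ, ℓ) > 0`" — GIP's printed case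
analysis (`GIP2017_prop20_corrected_of_prop18`) on the now proved Prop. 18.
[cite: GesmundoIkenmeyerPanova2017, Prop. 20] -/
theorem GIP2017_prop20_corrected_holds : GIP2017_prop20_corrected :=
  GIP2017_prop20_corrected_of_prop18 GIP2017_prop18_corrected_holds

/-- **GIP Prop. 14 — DISCHARGED.** [cite: GesmundoIkenmeyerPanova2017, Prop. 14] -/
theorem GIP2017_prop14_holds : GIP2017_prop14 :=
  GIP2017_prop14_of_prop20_corrected GIP2017_prop20_corrected_holds

/-- **GIP Thm. 10 (Main Result) — DISCHARGED**: for `n ≥ 10`, `n ≤ m`, `d ≥ 1`, no `λ ⊢ dn` with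
`ℓ(λ) ≤ m²` is an orbit occurrence obstruction against `per_n ∈ \overline{GL_{m²} · Pow^n_m}`
(rendering of `GCTMatrixPowering.lean`); every step of the printed proof is now proved in the tree.
[cite: GesmundoIkenmeyerPanova2017, Thm. 10] -/
theorem GIP2017_thm10_holds : GIP2017_thm10 :=
  GIP2017_thm10_of_prop20_corrected GIP2017_prop20_corrected_holds

/-- **The barrier fact `GCTMatrixPowering` (= GIP Thm. 10) — DISCHARGED.**
[cite: GesmundoIkenmeyerPanova2017, Thm. 10] -/
theorem GCTMatrixPowering_holds : GCTMatrixPowering :=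
  gctMatrixPowering_of_prop20_corrected GIP2017_prop20_corrected_holds

end Literature.Barriers.ValiantsHypothesis

end
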